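import Mathlib.MeasureTheory.Integral.IntervalIntegral.Basic
import Literature.Geometry.Lorentzian.MassCapacity
import Literature.Geometry.Lorentzian.HarmonicallyFlat
import HarnessLib

/-!
# Bray's conformal flow of metrics: the objects of §§2–3 and the assembly of the Penrose
# inequality for harmonically flat manifolds from Theorems 2–4 (family `gr`, proof architecture
# of **gr.S09** `riemannian_penrose_inequality`; namespace `Literature.Geometry.Lorentzian`)

Bray, J. Differential Geom. 59 (2001) 177–267 (arXiv:math/9911173; theorem, lemma and
definition numbers agree) proves the Riemannian Penrose inequality — Thm. 1 (p. 185): *let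
`(M³, g)` be a complete, smooth, asymptotically flat `3`-manifold with nonnegative scalar
curvature, total mass `m`, and an outer-minimizing horizon (with one or more components) of
total area `A`; then `m ≥ √(A/16π)`* — in two moves:

1. **Harmonically flat manifolds (§3, "Overview of the proof").** Under the standing
   *Assumption* of §3 — `(M³, g₀)` complete, smooth, harmonically flat at infinity (Def. 1), with
   nonnegative scalar curvature and an outer-minimizing horizon `Σ₀` (Def. 6, in the class `𝒮` of
   Def. 3) of total area `A₀` — the *conformal flow of metrics* `g_t = u_t⁴ g₀` of §3 (the four
   displayed equations to which Thm. 2 refers: `g_t = u_t(x)⁴ g₀` with `u₀ ≡ 1`; `Σ(t)` = the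
   outermost minimal area enclosure of `Σ₀` in `(M³, g_t)`, staying inside `𝒮`; `Δ_{g₀} v_t ≡ 0`
   outside `Σ(t)`, `v_t = 0` on `Σ(t)`, `lim_{x→∞} v_t = -e^{-t}`, `v_t ≡ 0` inside `Σ(t)`; and
   `u_t = 1 + ∫₀ᵗ v_s ds`) has a solution with the regularity and geometry asserted in **Thm. 2**;
   along it the area `A(t)` of `Σ(t)` in `g_t` (Def. 7) is constant and the total mass `m(t)` of
   `(M³, g_t)` (Def. 8) is nonincreasing, **Thm. 3**; and `(M³, g_t)` outside `Σ(t)` approaches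
   a Schwarzschild exterior, whence `lim_{t→∞} m(t)/√A(t) = √(1/16π)`, **Thm. 4**. *"Inequality
   [of Thm. 1] then follows from theorems 2, 3 and 4, for harmonically flat manifolds"* (§3):
   `m = m(0) ≥ lim_t m(t) = √(A₀/16π)`.
2. **Asymptotically flat manifolds (§13, proof of (226)).** *"Otherwise, given an
   asymptotically flat counterexample, we could use lemma 1 [Schoen–Yau] to perturb the manifold
   slightly making it harmonically flat at infinity such that it still violated equation (226).
   Then applying the conformal flow of metrics to this harmonically flat manifold would violate
   theorems 3 and 4, which is a contradiction. Setting `t = 0` in inequality (226) then proves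
   the Riemannian Penrose inequality for asymptotically flat manifolds."*

This file vendors the **objects** of §§2–3 as definitions with proved API, records the
conclusions of Thms. 2–4 for given data as a **predicate**, and proves the **assembly 1.**:

* `AFEnd.IsHarmonicallyFlatCoeffWith`, `conformalCoeff`, `HasConformalHFMass` — Def. 1 and
  Def. 2 (total mass `2ab` from the expansion (10) of the conformal factor) for the chart
  coefficients `(w ∘ Φ)⁴ h_ij` of a conformal metric `w⁴ h` on the end `e`, which is how Bray
  computes `m(t)` (§7: *"we will also let `g_t = 𝒰_t(x)⁴ g_flat` in the harmonically flat end.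
  Then since `g_t = u_t(x)⁴ g₀`, it follows that `𝒰_t(x) = u_t(x) 𝒰₀(x)` … so that by
  definition 2, `m(t) = 2α(t)(β(t) + m(0)α(t)/2)`"*); with `HasConformalHFMass.unique` (well
  defined) and `HasConformalHFMass.eq_of_hasHarmonicallyFlatMass` (`w ≡ 1` gives back the mass
  of `HarmonicallyFlat.lean`), proved;
* `IsCalS h e V` — Bray's class `𝒮` (Def. 3) described by the open *outside* region `V` of the
  surface towards the chosen end `e`, through the tree's `IsOutsideOf` (`MassCapacity.lean`);
  `conformalArea h w s` — the area of `s ⊆ X` in the metric `w⁴ h`; `IsOuterMinimizing`,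
  `IsStrictlyOuterMinimizing` — Def. 6; `IsMinimalAreaEnclosure`,
  `IsOutermostMinimalAreaEnclosure` — the (outermost) minimal area enclosure of `Σ₀` among
  surfaces of `𝒮` (§3, second displayed equation; §4, Def. 10), all in the metric `w⁴ h`, with
  the elementary consequences `conformalArea_eq_of_isOuterMinimizing` (`A(0) = A₀`) and
  `eq_of_isStrictlyOuterMinimizing` (`Σ(0) = Σ₀`), proved;
* `normalDeriv`, `conformalMeanCurvature`, `IsConformalHorizon`, `IsConformalHorizonOutside` —
  the mean curvature of a surface in `(X, w⁴ h)` by the transformation law printed in the proof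
  of Lemma 9 (§4), `H = u_t⁻² H₀ + 4 u_t⁻³ ∇_ν u_t`, and horizons (Def. 4) of `(X, w⁴ h)` of
  class `𝒮`;
* `IsConformalFlow h e U₀ u v U` — **the object of Thm. 2**: a solution `(u_t, v_t, Σ(t))` of
  the system of §3 with the regularity and geometric properties listed in Thm. 2 (and
  `u_t > 0`, the sentence following it); `flowArea` — `A(t)` of Def. 7; API `le_init`,
  `antitone`, `isCalS`, `u_zero_apply`, `flowArea_zero`, `init_eq_zero`,
  `flowArea_zero_eq_of_isOuterMinimizing`, proved;
* `HasConformalFlowHF D e U₀` — **predicate**: the data carry a conformal flow from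
  `Σ₀ = frontier U₀` with the properties of Thms. 2, 3 (`A(t) = |Σ₀|_{g₀}`, `m(t)` nonincreasing)
  and 4 (`m(t)/√A(t) → √(1/16π)`);
* `rpi_harmonicallyFlat_of_hasConformalFlowHF` — **theorem**: the assembly 1. — a harmonically
  flat end of total mass `m₀` (Def. 2) whose data carry such a flow satisfies
  `√(|Σ₀|_{g₀}/16π) ≤ m₀`; `IsOutsideOf.rpi_harmonicallyFlat_of_hasConformalFlowHF` — the same
  with `|Σ₀| = area D.h (range f₀)` for a horizon given with its outside region.

## What is not vendored here, and why

* **The existence statement of Thms. 2–4** (under the Assumption of §3 the data carry such a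
  flow: `HasConformalFlowHF`) and **the perturbation step of §13** (an asymptotically flat
  counterexample to Thm. 1 yields a harmonically flat one) are the two analytic results on which
  1. and 2. rest (§§4–12; Lemma 1). They are research-level (minimal-surface existence and
  regularity, elliptic theory on asymptotically flat ends, the positive mass theorem) and are
  deliberately not stated here as named facts (unproved literature facts enter the tree only on
  request, D-0026). The assembly therefore takes the flow as the hypothesis
  `HasConformalFlowHF D e U₀`; a later vendoring of Thms. 2–4 (and of Thm. 18, their
  asymptotically flat version) as named facts has only to conclude this predicate, and 2. is then
  the contrapositive of `rpi_harmonicallyFlat_of_hasConformalFlowHF` composed with the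
  perturbation step.
* **Relation to the gr.S09 facts.** The corrected gr.S09 statement
  `riemannian_penrose_inequality_smooth` (`OutermostHorizon.lean`) is reduced in
  `OutermostHorizonSmooth.lean` to Huisken–Ilmanen's Lemma 4.1 (i), the boundary maximum
  principle, and `Bray2001_penrose_inequality_exteriorRegion` = Thm. 19 (Thm. 1 *with boundary*)
  combined with Huisken–Ilmanen's Lemma 4.1 (ii), for exterior regions `U` whose boundary may
  contain components with `U` **on both sides** (doubled in the boundary of the metric
  completion `M'` of `U`). Such a boundary is not a surface of Bray's class `𝒮` in `X` (Def. 3: a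
  surface of `𝒮` is the boundary of the open set it encloses, so its outside lies on one side of
  it — the clause of `IsOutsideOf`), the flow of §3 cannot be started at it inside `X`, and Bray
  obtains Thm. 19 from Thm. 1 only by the remark that nothing inside the horizon is used (§13,
  before Thm. 19) — in effect by filling in the boundary components, which changes the ambient
  manifold. The flow vocabulary of this file is therefore that of Thm. 1 (horizons of class `𝒮`);
  Thm. 19's doubling, and "outermost horizons are always strictly outer-minimizing" (p. 185;
  Huisken–Ilmanen, Lemma 4.1 (ii)), stay with that named fact.
* **Areas** are the `2`-dimensional Hausdorff areas `area h s` of `Volume.lean` of subsets of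
  `X` (`Σ(t)` is known only as a boundary); their agreement with the Riemannian area
  `totalArea (f^* h)` of a parametrising surface (`OutermostMOTS.surfaceArea`; Federer, 3.2.3 and
  3.2.46) is not in the tree and not needed here.

## Design

* **Thms. 2–4 as properties of one solution.** Thm. 2 asserts that the system of §3 *"has a
  solution"* with the stated properties; §4 constructs it as a limit of the time-discretised
  flows `u_t^ε` (§4: Cor. 1, Def. 10, Lemma 8), and Thm. 3 (§4 Lemma 5 with §5 for `A(t)`, §7
  Thm. 10 for `m(t)`) and Thm. 4 (§§8–12) are proved for the solution so constructed — no
  uniqueness for the system is claimed. Hence `HasConformalFlowHF` says *"there is a solution as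
  in Thm. 2 for which moreover `A(t) = A₀`, `m(t)` is nonincreasing and
  `m(t)/√A(t) → √(1/16π)`"*, and the structure `IsConformalFlow` records all of Thm. 2's
  properties so that this is the printed object and not a weaker surrogate.
* **No conformal metric is constructed.** `g_t = u_t⁴ g₀` with `u_t` only `C¹` across the
  earlier horizons is not a `ContMDiffRiemannianMetric`; every quantity of `g_t` that the source
  uses is computed from `u_t` and `g₀` by the printed formulas: areas by the density `u_t⁴`
  against the `2`-dimensional Hausdorff measure of `g₀` (`conformalArea`; Bray, §5:
  `A^ε(ε) = ∫_{Σ^ε(ε)} (1 + ε v₀^ε)⁴ dA_{g₀^ε}`, §10: `|Σ_i(t̄)|_{g_t̄} = ∫ 𝒰_t̄⁴ dA_{g_flat}`), the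
  total mass by Def. 2 applied to the factor `𝒰_t = u_t 𝒰₀` of the chart coefficients (§7,
  quoted above; `HasConformalHFMass`), the mean curvature by the law quoted above
  (`conformalMeanCurvature`), and `Δ_{g₀}` is the tree's `PseudoRiemannianMetric.dalembertian` of
  `g₀ = h`.
* **The class `𝒮` by outside regions.** Def. 3 compactifies the other ends and lets `𝒮` be the
  smooth compact boundaries of open sets containing the points `∞_k`; a surface `Σ ∈ 𝒮` has an
  inside (that open set) and an outside, and *encloses* `Σ'` when its inside contains that of
  `Σ'`. As in `MassCapacity.lean` (Thm. 9) a surface of `𝒮` is handled through its open outside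
  region `V` towards `e` (`IsOutsideOf e V f ν`: `frontier V = range f` for a compact embedded
  surface `f` with unit normal `ν` pointing into `V`, `V` on one side of each component, and
  `IsExteriorRegion e V`: `V` connected, containing a far region of `e`, compact modulo it — so
  the inside is the side of the compactified ends and not of the chosen one), and `IsCalS h e V`
  says that `V` is such an outside region for *some* compact smoothly embedded surface;
  "`Σ_{V'}` encloses `Σ_V`" is `V' ⊆ V`. Two immaterial deviations from the letter of Def. 3 are
  inherited from `IsOutsideOf`: outside regions are connected, and boundaries along which the
  *inside* lies on both sides are not represented (both only affect surfaces of larger area than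
  a competitor without the extra pieces, so minimal area enclosures, Def. 6 for the surfaces at
  hand, and the flow are unchanged).
* **Degenerate values.** Areas live in `ℝ≥0∞` and enter the mass–area quotient through
  `ENNReal.toReal`. For a nonempty compact smooth horizon `0 < A₀ < ∞`, so no junk value is met in
  the source's setting; the assembly treats the value `A₀.toReal = 0` separately (there the limit
  clause of Thm. 4 is contradictory) rather than assume it away.

## References

* H. L. Bray, *Proof of the Riemannian Penrose inequality using the positive mass theorem*,
  J. Differential Geom. 59 (2001) 177–267 (arXiv:math/9911173): §2 Defs. 1–6, (10), Lemma 1,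
  Thm. 1; §3 (the flow, Thms. 2–4, Defs. 7–8); §4 Cor. 1, Def. 10, Lemmas 5, 8, 9; §5; §7 (the
  computation of `m(t)` by Def. 2, Thm. 10); §10 (areas in `g_t`); §13 Def. 21, (225), Thm. 18,
  (226), Thm. 19.
* G. Huisken, T. Ilmanen, *The inverse mean curvature flow and the Riemannian Penrose
  inequality*, J. Differential Geom. 59 (2001) 353–437, Lemma 4.1 (for the relation above).
* H. Federer, *Geometric Measure Theory*, Springer 1969, 3.2.3, 3.2.46 (area of images).
-/

noncomputable section

open Bundle Set Manifold TopologicalSpace Filter MeasureTheory Asymptotics Bornology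
open scoped ContDiff Topology ENNReal Manifold Real

namespace Literature.Geometry.Lorentzian

open PseudoRiemannianMetric

variable {X : Type} [TopologicalSpace X] [ChartedSpace E3 X]

/-! ### Harmonically flat chart coefficients and their total mass (Defs. 1–2 for coefficients) -/

section Coeff

/-- **A field of chart coefficients `g` on the end `e` is harmonically flat beyond radius `R₁`
with conformal factor `W`** — Bray, J. Differential Geom. 59 (2001), §2, Def. 1 with (9) and the
sentence following it, stated for an arbitrary coefficient field `g : E3 → (E3 →L E3 →L ℝ)` (as
`AFEnd.IsHarmonicallyFlatWith` of `HarmonicallyFlat.lean` is for `g = hCoeff e D`, minus the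
scalar-curvature clause, which needs the data `D`): `e.R ≤ R₁`; on `{R₁ < ‖x‖}`,
`g(x) = W(x)⁴ δ` with `W(x) > 0` and `W` harmonic for the flat Laplacian (*"this implies that
`𝒰₀(x)` is harmonic in `(ℝ³ ∖ B₁(0), δ)`"*); and `W → a` at infinity for some `a > 0` (*"the
conformal factor approaching a positive constant at infinity"*). Used for the coefficients
`(u_t ∘ Φ)⁴ h_ij = 𝒰_t⁴ δ_ij`, `𝒰_t = u_t 𝒰₀`, of the metrics `g_t = u_t⁴ g₀` of the conformal flow
(§7). [cite: BrayRPI2001, §2 Def. 1 with (9), and §7 (the factor 𝒰_t = u_t 𝒰₀)] -/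
def AFEnd.IsHarmonicallyFlatCoeffWith (e : AFEnd X) (g : E3 → E3 →L[ℝ] E3 →L[ℝ] ℝ) (R₁ : ℝ)
    (W : E3 → ℝ) : Prop :=
  e.R ≤ R₁ ∧
  (∀ x : E3, R₁ < ‖x‖ →
    0 < W x ∧ g x = (W x) ^ 4 • (innerSL ℝ (E := E3) : E3 →L[ℝ] E3 →L[ℝ] ℝ)) ∧
  InnerProductSpace.HarmonicOnNhd W {x : E3 | R₁ < ‖x‖} ∧
  ∃ a : ℝ, 0 < a ∧ Tendsto W (cobounded E3) (𝓝 a)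

namespace AFEnd.IsHarmonicallyFlatCoeffWith

variable {e : AFEnd X} {g g' : E3 → E3 →L[ℝ] E3 →L[ℝ] ℝ} {R₁ R₂ : ℝ} {W V : E3 → ℝ}

/-- The radius of harmonic flatness is at least the inner radius of the end. [folklore] -/
lemma le_radius (hW : e.IsHarmonicallyFlatCoeffWith g R₁ W) : e.R ≤ R₁ :=
  hW.1

/-- The conformal factor is positive beyond the radius. [cite: BrayRPI2001, §2 Def. 1] -/
lemma pos (hW : e.IsHarmonicallyFlatCoeffWith g R₁ W) {x : E3} (hx : R₁ < ‖x‖) : 0 < W x :=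
  (hW.2.1 x hx).1

/-- Beyond the radius the coefficients are `W⁴ δ`. [cite: BrayRPI2001, §2 (9)] -/
lemma coeff_eq (hW : e.IsHarmonicallyFlatCoeffWith g R₁ W) {x : E3} (hx : R₁ < ‖x‖) :
    g x = (W x) ^ 4 • (innerSL ℝ (E := E3) : E3 →L[ℝ] E3 →L[ℝ] ℝ) :=
  (hW.2.1 x hx).2

/-- The conformal factor is harmonic beyond the radius. [cite: BrayRPI2001, §2 after (9)] -/
lemma harmonicOnNhd (hW : e.IsHarmonicallyFlatCoeffWith g R₁ W) :
    InnerProductSpace.HarmonicOnNhd W {x : E3 | R₁ < ‖x‖} :=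
  hW.2.2.1

/-- The conformal factor tends to a positive constant. [cite: BrayRPI2001, §2 Def. 1] -/
lemma exists_tendsto (hW : e.IsHarmonicallyFlatCoeffWith g R₁ W) :
    ∃ a : ℝ, 0 < a ∧ Tendsto W (cobounded E3) (𝓝 a) :=
  hW.2.2.2

/-- Harmonic flatness beyond `R₁` persists beyond any larger radius. [folklore] -/
lemma mono (hW : e.IsHarmonicallyFlatCoeffWith g R₁ W) (hR : R₁ ≤ R₂) :
    e.IsHarmonicallyFlatCoeffWith g R₂ W :=
  ⟨hW.1.trans hR, fun x hx ↦ hW.2.1 x (hR.trans_lt hx), hW.2.2.1.mono fun _ hx ↦ hR.trans_lt hx,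
    hW.2.2.2⟩

/-- **The conformal factor is determined by the coefficients**: where two coefficient fields
agree, their positive fourth roots agree (`W⁴ δ = V⁴ δ` evaluated on a unit vector). Bray 2001,
§2, (9). [cite: BrayRPI2001, §2 (9)] -/
theorem factor_eq (hW : e.IsHarmonicallyFlatCoeffWith g R₁ W)
    (hV : e.IsHarmonicallyFlatCoeffWith g' R₂ V) {x : E3} (hx₁ : R₁ < ‖x‖) (hx₂ : R₂ < ‖x‖)
    (hgg' : g x = g' x) : W x = V x := by
  have h4 : (W x) ^ 4 = (V x) ^ 4 := by
    have := ((hW.coeff_eq hx₁).symm.trans hgg').trans (hV.coeff_eq hx₂)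
    have hv : (innerSL ℝ (E := E3) : E3 →L[ℝ] E3 →L[ℝ] ℝ) (EuclideanSpace.single 0 1)
        (EuclideanSpace.single 0 1) = 1 := by
      change inner ℝ (EuclideanSpace.single (0 : Fin 3) (1 : ℝ)) (EuclideanSpace.single 0 1) = 1
      simp
    have h1 := congrArg (fun B : E3 →L[ℝ] E3 →L[ℝ] ℝ ↦
      B (EuclideanSpace.single 0 1) (EuclideanSpace.single 0 1)) this
    simp only [smul_apply, smul_eq_mul, hv, mul_one] at h1
    exact h1
  exact (pow_left_inj₀ (hW.pos hx₁).le (hV.pos hx₂).le (by norm_num)).1 h4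

/-- Conformal factors of coefficient fields that agree near infinity agree near infinity.
[folklore] -/
theorem factor_eventuallyEq (hW : e.IsHarmonicallyFlatCoeffWith g R₁ W)
    (hV : e.IsHarmonicallyFlatCoeffWith g' R₂ V) (hgg' : g =ᶠ[cobounded E3] g') :
    W =ᶠ[cobounded E3] V := by
  filter_upwards [eventually_cobounded_le_norm (E := E3) (max R₁ R₂ + 1), hgg'] with x hx hx'
  exact hW.factor_eq hV (by linarith [le_max_left R₁ R₂]) (by linarith [le_max_right R₁ R₂]) hx'

end AFEnd.IsHarmonicallyFlatCoeffWith

variable [IsManifold (𝓡 3) ∞ X] (e : AFEnd X) (D : InitialDataSet (𝓡 3) X)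

/-- A harmonically flat end (Def. 1, `HarmonicallyFlat.lean`) has harmonically flat chart
coefficients `hCoeff e D` with the same radius and factor (forget the scalar-curvature clause).
[cite: BrayRPI2001, §2 Def. 1] -/
theorem AFEnd.IsHarmonicallyFlatWith.coeffWith [D.metric.HasLeviCivita] {R₁ : ℝ} {U : E3 → ℝ}
    (hU : e.IsHarmonicallyFlatWith D R₁ U) :
    e.IsHarmonicallyFlatCoeffWith (AFEnd.hCoeff e D) R₁ U :=
  ⟨hU.le_radius, fun _ hx ↦ ⟨hU.pos hx, hU.hCoeff_eq hx⟩, hU.harmonicOnNhd, hU.exists_tendsto⟩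

/-- **The chart coefficients of the conformal metric `w⁴ h` on the end `e`**: for `R < ‖x‖`,
`(w(Φ x))⁴ · h_ij(x)` with `Φ = e.dataChart` the inverse chart and `h_ij = hCoeff e D` (the
pullback of `w⁴ h` along `Φ` is `(w ∘ Φ)⁴ Φ^* h`); inside the closed ball `‖x‖ ≤ R` the junk value
of `hCoeff` itself (so that `w ≡ 1` gives back `hCoeff` everywhere, `conformalCoeff_one`). This is
the object `𝒰_t⁴ δ_ij = (u_t 𝒰₀)⁴ δ_ij` of §7 for `w = u_t`, `h = g₀ = 𝒰₀⁴ δ`. Bray 2001, §3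
(`g_t = u_t⁴ g₀`) and §7 (`𝒰_t = u_t 𝒰₀`). [cite: BrayRPI2001, §3 (g_t = u_t⁴ g₀) and §7 (𝒰_t = u_t 𝒰₀)] -/
def conformalCoeff (w : X → ℝ) (x : E3) : E3 →L[ℝ] E3 →L[ℝ] ℝ :=
  if hx : e.R < ‖x‖ then (w (e.dataChart ⟨x, hx⟩)) ^ 4 • AFEnd.hCoeff e D x
  else AFEnd.hCoeff e D x

/-- Outside the ball the conformal coefficients are `(w ∘ Φ)⁴ h_ij`. [cite: BrayRPI2001, §7 (𝒰_t = u_t 𝒰₀)] -/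
theorem conformalCoeff_of_lt (w : X → ℝ) {x : E3} (hx : e.R < ‖x‖) :
    conformalCoeff e D w x = (w (e.dataChart ⟨x, hx⟩)) ^ 4 • AFEnd.hCoeff e D x :=
  dif_pos hx

/-- Outside the ball the conformal coefficients are `(endValue e w)⁴ h_ij` (`endValue` of
`MassCapacity.lean`: `w` read in the chart). [folklore] -/
theorem conformalCoeff_eq_endValue_pow_smul (w : X → ℝ) {x : E3} (hx : e.R < ‖x‖) :
    conformalCoeff e D w x = (endValue e w x) ^ 4 • AFEnd.hCoeff e D x := by
  rw [conformalCoeff_of_lt e D w hx, endValue_of_lt e w hx]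

/-- For the conformal factor `w ≡ 1` the conformal coefficients are the chart coefficients of
`h` (everywhere, by the choice of junk value). [folklore] -/
@[simp]
theorem conformalCoeff_one : conformalCoeff e D (fun _ ↦ (1 : ℝ)) = AFEnd.hCoeff e D := by
  funext x
  unfold conformalCoeff
  split_ifs <;> simp

/-- **The conformal metric `w⁴ h` has Bray total mass `m` on the end `e`** (Def. 8: *"`m(t)` is
defined to be the total mass of `(M³, g_t)` in the chosen end"*, computed in §7 by Def. 2:
*"we will also let `g_t = 𝒰_t(x)⁴ g_flat` in the harmonically flat end. Then since
`g_t = u_t(x)⁴ g₀`, it follows that `𝒰_t(x) = u_t(x) 𝒰₀(x)` … so that by definition 2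
`m(t) = 2α(t)(β(t) + m(0)α(t)/2)`"*): the chart coefficients `conformalCoeff e D w` of `w⁴ h`
are harmonically flat beyond some radius with a conformal factor `W` (`= (w ∘ Φ) · 𝒰₀`) having
the expansion (10), `W = a + b/|x| + O(|x|⁻²)`, and `m = 2ab` (Def. 2). Well defined
(`HasConformalHFMass.unique`); for `w ≡ 1` it is the total mass `e.HasHarmonicallyFlatMass D` of
`HarmonicallyFlat.lean` (`eq_of_hasHarmonicallyFlatMass`).
[cite: BrayRPI2001, §3 Def. 8 with §2 Def. 2, (10), and §7 (m(t) by Def. 2)] -/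
def HasConformalHFMass (w : X → ℝ) (m : ℝ) : Prop :=
  ∃ (R₁ : ℝ) (W : E3 → ℝ) (a b : ℝ),
    e.IsHarmonicallyFlatCoeffWith (conformalCoeff e D w) R₁ W ∧ HasHarmonicExpansion W a b ∧
      m = 2 * a * b

variable {e D}

/-- **The total mass of a conformal metric is well defined** (the factor is determined near
infinity, `factor_eventuallyEq`, hence so are `a`, `b`, `HasHarmonicExpansion.unique`). Bray
2001, §2, after Def. 2. [cite: BrayRPI2001, §2 Def. 2] -/
theorem HasConformalHFMass.unique {w : X → ℝ} {m m' : ℝ} (hm : HasConformalHFMass e D w m)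
    (hm' : HasConformalHFMass e D w m') : m = m' := by
  obtain ⟨R₁, W, a, b, hW, hab, rfl⟩ := hm
  obtain ⟨R₂, V, a', b', hV, hab', rfl⟩ := hm'
  obtain ⟨rfl, rfl⟩ := hab.unique hab' (hW.factor_eventuallyEq hV EventuallyEq.rfl)
  rfl

/-- A harmonically flat end of total mass `m` (Def. 2) is, as the conformal metric `1⁴ h`, of
total mass `m`. [cite: BrayRPI2001, §2 Def. 2] -/
theorem AFEnd.HasHarmonicallyFlatMass.hasConformalHFMass_one [D.metric.HasLeviCivita] {m : ℝ}
    (hm : e.HasHarmonicallyFlatMass D m) : HasConformalHFMass e D (fun _ ↦ (1 : ℝ)) m := by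
  obtain ⟨R₁, U, a, b, hU, hab, rfl⟩ := hm
  exact ⟨R₁, U, a, b, by simpa using hU.coeffWith, hab, rfl⟩

/-- **`m(0) = m₀`**: the total mass of the conformal metric with factor `u₀ ≡ 1` is the total
mass of the harmonically flat end (both are Def. 2 masses of the same coefficients; Bray 2001,
§7: `u₀ ≡ 1`, so `α(0) = 1`, `β(0) = 0` and `m(0)` is the total mass of `g₀`).
[cite: BrayRPI2001, §2 Def. 2 and §7] -/
theorem HasConformalHFMass.eq_of_hasHarmonicallyFlatMass [D.metric.HasLeviCivita] {m m₀ : ℝ}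
    (hm : HasConformalHFMass e D (fun _ ↦ (1 : ℝ)) m) (hm₀ : e.HasHarmonicallyFlatMass D m₀) :
    m = m₀ :=
  hm.unique hm₀.hasConformalHFMass_one

end Coeff

/-! ### The class `𝒮` by outside regions; areas in a conformal metric; Def. 6; enclosures -/

section CalS

variable [IsManifold (𝓡 3) ∞ X]
  (h : ContMDiffRiemannianMetric (𝓡 3) ∞ E3 (TangentSpace (𝓡 3) : X → Type _))

/-- **`V` is the outside region (towards the end `e`) of a surface of Bray's class `𝒮`** (Bray,
J. Differential Geom. 59 (2001), §2, Def. 3: *"define `𝒮` to be the collection of surfaces which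
are smooth compact boundaries of open sets in `M³` containing the points `{∞_k}`"* — the other
ends being compactified — *"all of the surfaces in `𝒮` divide `M³` into two regions, an inside
(the open set) and an outside (the complement of the open set)"*), in the tree's encoding by the
open outside region (`IsOutsideOf` of `MassCapacity.lean`): for **some** compact smooth
`2`-manifold `S'`, smooth embedding `f' : S' → X` and unit normal `ν'` along it (for `h`; only
its direction matters), `IsOutsideOf e V f' ν'` holds — `frontier V = range f'`, `ν'` points into
`V` and `-ν'` out of `closure V` (the outside `V` lies on one side of each component: the surface
is the boundary of its inside `X ∖ closure V`), and `V` is the exterior region of the end `e`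
(`IsExteriorRegion`: connected, containing a far region `e.far R'`, `closure V ∖ e.far R'`
compact — "containing the points `∞_k`" for the inside). The empty surface is allowed (`V = X`
when `X` has just the end `e`). See the module docstring ("The class `𝒮` by outside regions")
for the two immaterial deviations from the letter of Def. 3. [cite: BrayRPI2001, §2 Def. 3] -/
def IsCalS (e : AFEnd X) (V : Opens X) : Prop :=
  ∃ (S' : Type) (_ : TopologicalSpace S') (_ : ChartedSpace (EuclideanSpace ℝ (Fin 2)) S')
    (_ : IsManifold (𝓡 2) ∞ S') (_ : CompactSpace S') (_ : T2Space S')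
    (f' : S' → X) (ν' : NormalField (𝓡 3) f'),
    Manifold.IsSmoothEmbedding (𝓡 2) (𝓡 3) ∞ f' ∧ (ofRiemannian h).IsUnitNormal (𝓡 2) f' ν' 1 ∧
      IsOutsideOf e V f' ν'

/-- The outside region of an embedded compact surface with unit normal (`IsOutsideOf`) is the
outside region of a surface of `𝒮`. Bray 2001, Def. 3. [cite: BrayRPI2001, §2 Def. 3] -/
theorem IsOutsideOf.isCalS {e : AFEnd X} {V : Opens X} {S' : Type} [t : TopologicalSpace S']
    [c : ChartedSpace (EuclideanSpace ℝ (Fin 2)) S'] [m : IsManifold (𝓡 2) ∞ S']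
    [k : CompactSpace S'] [t2 : T2Space S'] {f' : S' → X} {ν' : NormalField (𝓡 3) f'}
    (hV : IsOutsideOf e V f' ν') (hf' : Manifold.IsSmoothEmbedding (𝓡 2) (𝓡 3) ∞ f')
    (hν' : (ofRiemannian h).IsUnitNormal (𝓡 2) f' ν' 1) : IsCalS h e V :=
  ⟨S', t, c, m, k, t2, f', ν', hf', hν', hV⟩

/-- The outside region of a surface of `𝒮` is the exterior region of the end. Bray 2001, Def. 3
("containing the points `∞_k`"). [cite: BrayRPI2001, §2 Def. 3] -/
theorem IsCalS.isExteriorRegion {e : AFEnd X} {V : Opens X} (hV : IsCalS h e V) :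
    IsExteriorRegion e V := by
  obtain ⟨_, _, _, _, _, _, _, _, -, -, hout⟩ := hV
  exact hout.isExteriorRegion

variable [T2Space X] [LocallyCompactSpace X] [MeasurableSpace X] [BorelSpace X]

/-- **The area of `s ⊆ X` in the conformal metric `w⁴ h`**: `∫_s w⁴ dμ²_h`, the density `w⁴`
against the `2`-dimensional (Euclidean-normalised Hausdorff) area measure `riemannianVolume h 2`
of `Volume.lean` — the way Bray computes areas in the metrics of the flow (§5:
`A^ε(ε) = ∫_{Σ^ε(ε)} (1 + ε v₀^ε(x))⁴ dA_{g₀^ε}`; §10: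
`|Σ_i(t̄)|_{g_t̄} = ∫_{Σ_i(t̄)} 𝒰_t̄(x)⁴ dA_{g_flat}`; lengths scale by `w²` and areas by `w⁴` under
`g ↦ w⁴ g`). A lower Lebesgue integral in `ℝ≥0∞`;
for `w ≡ 1` it is `area h s` (`conformalArea_one`).
[cite: BrayRPI2001, §5 (A^ε(ε) as ∫ (1 + ε v)^4 dA) and §10 (|Σ_i(t̄)|_{g_t̄} = ∫ 𝒰_t̄⁴ dA_{g_flat})] -/
def conformalArea (w : X → ℝ) (s : Set X) : ℝ≥0∞ :=
  ∫⁻ x in s, ENNReal.ofReal (w x ^ 4) ∂(riemannianVolume h 2)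

/-- With conformal factor `1` the conformal area is the area. [folklore] -/
@[simp]
theorem conformalArea_one (s : Set X) : conformalArea h (fun _ ↦ (1 : ℝ)) s = area h s := by
  simp [conformalArea, area]

/-- **Outer-minimizing in `(X, w⁴ h)`** (Bray 2001, §2, Def. 6: *"a surface `Σ ∈ 𝒮` is defined to
be (strictly) outer-minimizing if every other surface `Σ̃ ∈ 𝒮` which encloses it has (strictly)
greater area"*, non-strict reading): every outside region `V' ⊆ V` of a surface of `𝒮`
(i.e. every `Σ̃ = frontier V'` of `𝒮` enclosing `Σ = frontier V`) has `w⁴ h`-area at least that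
of `frontier V`. For the metric `h` itself take `w ≡ 1`. [cite: BrayRPI2001, §2 Def. 6] -/
def IsOuterMinimizing (w : X → ℝ) (e : AFEnd X) (V : Opens X) : Prop :=
  ∀ V' : Opens X, IsCalS h e V' → V' ≤ V →
    conformalArea h w (frontier (V : Set X)) ≤ conformalArea h w (frontier (V' : Set X))

/-- **Strictly outer-minimizing in `(X, w⁴ h)`** (Bray 2001, §2, Def. 6, strict reading): every
*other* surface of `𝒮` enclosing `frontier V` has strictly greater `w⁴ h`-area.
[cite: BrayRPI2001, §2 Def. 6] -/
def IsStrictlyOuterMinimizing (w : X → ℝ) (e : AFEnd X) (V : Opens X) : Prop :=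
  ∀ V' : Opens X, IsCalS h e V' → V' ≤ V → V' ≠ V →
    conformalArea h w (frontier (V : Set X)) < conformalArea h w (frontier (V' : Set X))

/-- Strictly outer-minimizing surfaces are outer-minimizing. Bray 2001, Def. 6.
[cite: BrayRPI2001, §2 Def. 6] -/
theorem IsStrictlyOuterMinimizing.isOuterMinimizing {w : X → ℝ} {e : AFEnd X} {V : Opens X}
    (hV : IsStrictlyOuterMinimizing h w e V) : IsOuterMinimizing h w e V := by
  intro V' hV' hle
  rcases eq_or_ne V' V with rfl | hne
  · exact le_rfl
  · exact (hV V' hV' hle hne).le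

/-- **`frontier V` is a minimal area enclosure of `Σ₀ = frontier U₀` in `(X, w⁴ h)`** (Bray 2001,
§3, the second of the four displayed equations of the flow: *"`Σ(t)` = the outermost minimal
area enclosure of `Σ₀` in `(M³, g_t)`, where … we stay inside the collection of surfaces `𝒮`"*;
§4, Def. 10): `V` is the outside region of a surface of `𝒮` enclosing `Σ₀` (`V ⊆ U₀`) whose
`w⁴ h`-area is least among all surfaces of `𝒮` enclosing `Σ₀`.
[cite: BrayRPI2001, §3 (definition of Σ(t)) and §4 Def. 10] -/
def IsMinimalAreaEnclosure (w : X → ℝ) (e : AFEnd X) (U₀ V : Opens X) : Prop :=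
  IsCalS h e V ∧ V ≤ U₀ ∧ ∀ V' : Opens X, IsCalS h e V' → V' ≤ U₀ →
    conformalArea h w (frontier (V : Set X)) ≤ conformalArea h w (frontier (V' : Set X))

/-- **`frontier V` is the outermost minimal area enclosure of `Σ₀ = frontier U₀` in `(X, w⁴ h)`**:
a minimal area enclosure enclosing every other one (`V ⊆ V'`); *"the outermost minimal area
enclosure of a smooth region is well-defined in that it always exists and is unique [BT]"* (§4,
after Def. 10). [cite: BrayRPI2001, §3 (definition of Σ(t)) and §4 Def. 10] -/
def IsOutermostMinimalAreaEnclosure (w : X → ℝ) (e : AFEnd X) (U₀ V : Opens X) : Prop :=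
  IsMinimalAreaEnclosure h w e U₀ V ∧ ∀ V' : Opens X, IsMinimalAreaEnclosure h w e U₀ V' → V ≤ V'

/-- A minimal area enclosure of a surface of `𝒮` has at most its area (the surface encloses
itself). [folklore] -/
theorem IsMinimalAreaEnclosure.conformalArea_le_of_isCalS {w : X → ℝ} {e : AFEnd X}
    {U₀ V : Opens X} (hV : IsMinimalAreaEnclosure h w e U₀ V) (hU₀ : IsCalS h e U₀) :
    conformalArea h w (frontier (V : Set X)) ≤ conformalArea h w (frontier (U₀ : Set X)) :=
  hV.2.2 U₀ hU₀ le_rfl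

/-- A minimal area enclosure of an outer-minimizing surface of `𝒮` has exactly its area (so
`A(0) = A₀` in §3). Bray 2001, §2, after Def. 6. [cite: BrayRPI2001, §2 Def. 6] -/
theorem IsMinimalAreaEnclosure.conformalArea_eq_of_isOuterMinimizing {w : X → ℝ} {e : AFEnd X}
    {U₀ V : Opens X} (hV : IsMinimalAreaEnclosure h w e U₀ V) (hU₀ : IsCalS h e U₀)
    (hmin : IsOuterMinimizing h w e U₀) :
    conformalArea h w (frontier (V : Set X)) = conformalArea h w (frontier (U₀ : Set X)) :=
  le_antisymm (hV.conformalArea_le_of_isCalS h hU₀) (hmin V hV.1 hV.2.1)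

/-- The only minimal area enclosure of a strictly outer-minimizing surface of `𝒮` is the
surface itself (so `Σ(0) = Σ₀` in §3 when `Σ₀` is strictly outer-minimizing). Bray 2001, §2,
Def. 6. [cite: BrayRPI2001, §2 Def. 6] -/
theorem IsMinimalAreaEnclosure.eq_of_isStrictlyOuterMinimizing {w : X → ℝ} {e : AFEnd X}
    {U₀ V : Opens X} (hV : IsMinimalAreaEnclosure h w e U₀ V) (hU₀ : IsCalS h e U₀)
    (hmin : IsStrictlyOuterMinimizing h w e U₀) : V = U₀ := by
  by_contra hne
  exact (hmin V hV.1 hV.2.1 hne).not_ge (hV.conformalArea_le_of_isCalS h hU₀)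

end CalS

/-! ### Mean curvature and horizons in a conformal metric -/

section Horizon

variable {S : Type*}

/-- The **normal derivative `∇_ν w`** of `w : X → ℝ` along `f : S → X` in the direction of the
field `ν` along `f`: `dw_{f y}(ν y)` (`mfderiv`, junk `0` where `w` is not differentiable; the
value type `TangentSpace 𝓘(ℝ, ℝ) _` is `ℝ`). Bray 2001, §4, proof of Lemma 9 (`∇_ν u_t`).
[cite: BrayRPI2001, §4, proof of Lemma 9] -/
def normalDeriv (w : X → ℝ) (f : S → X) (ν : NormalField (𝓡 3) f) (y : S) : ℝ :=
  show ℝ from mfderiv (𝓡 3) 𝓘(ℝ, ℝ) w (f y) (ν y)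

/-- Constants have vanishing normal derivative. [folklore] -/
@[simp]
theorem normalDeriv_const (c : ℝ) (f : S → X) (ν : NormalField (𝓡 3) f) (y : S) :
    normalDeriv (fun _ : X ↦ c) f ν y = 0 := by
  change (mfderiv (𝓡 3) 𝓘(ℝ, ℝ) (fun _ : X ↦ c) (f y)) (ν y) = (0 : ℝ)
  rw [mfderiv_const]
  rfl

variable [IsManifold (𝓡 3) ∞ X]
  (h : ContMDiffRiemannianMetric (𝓡 3) ∞ E3 (TangentSpace (𝓡 3) : X → Type _))
  [(ofRiemannian h).HasLeviCivita]
  [TopologicalSpace S] [ChartedSpace (EuclideanSpace ℝ (Fin 2)) S] [IsManifold (𝓡 2) ∞ S]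

/-- **The mean curvature of the surface `f` in the conformal metric `w⁴ h`**, by the
transformation law printed in Bray 2001, §4, proof of Lemma 9: *"the mean curvature of a
surface `Σ` in `(M³, g_t)` is `H = u_t(x)⁻² H₀ + 4 u_t(x)⁻³ ∇_ν u_t(x)`, where `H₀` is the mean
curvature and `ν` is the outward pointing unit normal vector of `Σ` in `(M³, g₀)`"* — here
`H₀ = (ofRiemannian h).meanCurvature f hpb hf ν` (tree convention `H = +div ν`, round sphere
`+2/r` for the outward normal, under which the law has this form) and `ν` the `h`-unit normal
along `f`; only first derivatives of `w` enter, so the formula applies to the `C¹` factors `u_t`.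
[cite: BrayRPI2001, §4, proof of Lemma 9 (mean curvature in g_t)] -/
def conformalMeanCurvature (w : X → ℝ) (f : S → X) (ν : NormalField (𝓡 3) f)
    (hpb : contMDiff_pullbackBilin (𝓡 3) X (𝓡 2) S ∞)
    (hf : (ofRiemannian h).IsSpacelikeImmersion (𝓡 2) f) (y : S) : ℝ :=
  (w (f y))⁻¹ ^ 2 * (ofRiemannian h).meanCurvature f hpb hf ν y +
    4 * (w (f y))⁻¹ ^ 3 * normalDeriv w f ν y

/-- With conformal factor `1` the conformal mean curvature is the mean curvature. [folklore] -/
@[simp]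
theorem conformalMeanCurvature_one (f : S → X) (ν : NormalField (𝓡 3) f)
    (hpb : contMDiff_pullbackBilin (𝓡 3) X (𝓡 2) S ∞)
    (hf : (ofRiemannian h).IsSpacelikeImmersion (𝓡 2) f) (y : S) :
    conformalMeanCurvature h (fun _ ↦ (1 : ℝ)) f ν hpb hf y =
      (ofRiemannian h).meanCurvature f hpb hf ν y := by
  simp [conformalMeanCurvature]

/-- **`f` is a horizon of `(X, w⁴ h)`** (Bray 2001, §2, Def. 4: *"a horizon of `(M³, g)` is any
zero mean curvature surface in `𝒮`"*, the mean curvature in `g_t = w⁴ h` being computed by the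
law of Lemma 9): `conformalMeanCurvature h w f ν = 0` identically. Membership in `𝒮` is recorded
separately (`IsConformalHorizonOutside`). [cite: BrayRPI2001, §2 Def. 4 with §4, proof of Lemma 9] -/
def IsConformalHorizon (w : X → ℝ) (f : S → X) (ν : NormalField (𝓡 3) f)
    (hpb : contMDiff_pullbackBilin (𝓡 3) X (𝓡 2) S ∞)
    (hf : (ofRiemannian h).IsSpacelikeImmersion (𝓡 2) f) : Prop :=
  ∀ y, conformalMeanCurvature h w f ν hpb hf y = 0

/-- With conformal factor `1`, horizons of `(X, 1⁴ h)` are the maximal (= minimal, `H = 0`)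
slices of `(X, h)` (`IsMaximalSlice`). [folklore] -/
theorem isConformalHorizon_one_iff (f : S → X) (ν : NormalField (𝓡 3) f)
    (hpb : contMDiff_pullbackBilin (𝓡 3) X (𝓡 2) S ∞)
    (hf : (ofRiemannian h).IsSpacelikeImmersion (𝓡 2) f) :
    IsConformalHorizon h (fun _ ↦ (1 : ℝ)) f ν hpb hf ↔
      (ofRiemannian h).IsMaximalSlice f hpb hf ν := by
  simp [IsConformalHorizon, IsMaximalSlice]

end Horizon

/-! ### The conformal flow of metrics (Thm. 2) -/

section Flow

variable [IsManifold (𝓡 3) ∞ X]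
  (h : ContMDiffRiemannianMetric (𝓡 3) ∞ E3 (TangentSpace (𝓡 3) : X → Type _))
  [(ofRiemannian h).HasLeviCivita]

/-- **`frontier V` is a smooth horizon of `(X, w⁴ h)` of class `𝒮` with outside region `V`**
(Bray 2001, Defs. 3–4, for the metric `g_t = w⁴ h`; Thm. 2: *"`Σ(t)` is a smooth … horizon in
`(M³, g_t)`"*): for some compact smooth `2`-manifold `S'`, smooth embedding `f'`, `h`-unit
normal `ν'` smooth as a map into `TX`, with `IsOutsideOf e V f' ν'` (so `frontier V = range f'`,
`ν'` the outward normal in Bray's sense, pointing into the outside `V`), the surface `f'` is a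
horizon of `(X, w⁴ h)` (`IsConformalHorizon`, the law of Lemma 9 with this outward `ν'`).
[cite: BrayRPI2001, §2 Defs. 3–4 and Thm. 2] -/
def IsConformalHorizonOutside (w : X → ℝ) (e : AFEnd X) (V : Opens X) : Prop :=
  ∃ (S' : Type) (_ : TopologicalSpace S') (_ : ChartedSpace (EuclideanSpace ℝ (Fin 2)) S')
    (_ : IsManifold (𝓡 2) ∞ S') (_ : CompactSpace S') (_ : T2Space S')
    (f' : S' → X) (ν' : NormalField (𝓡 3) f')
    (hpb' : contMDiff_pullbackBilin (𝓡 3) X (𝓡 2) S' ∞)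
    (hf' : (ofRiemannian h).IsSpacelikeImmersion (𝓡 2) f'),
    Manifold.IsSmoothEmbedding (𝓡 2) (𝓡 3) ∞ f' ∧ (ofRiemannian h).IsUnitNormal (𝓡 2) f' ν' 1 ∧
    ContMDiff (𝓡 2) (𝓡 3).tangent ∞
      (fun y ↦ (TotalSpace.mk' E3 (f' y) (ν' y) : TangentBundle (𝓡 3) X)) ∧
    IsOutsideOf e V f' ν' ∧ IsConformalHorizon h w f' ν' hpb' hf'

/-- The outside region of a horizon of class `𝒮` is the outside region of a surface of `𝒮`.
[cite: BrayRPI2001, §2 Defs. 3–4] -/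
theorem IsConformalHorizonOutside.isCalS {w : X → ℝ} {e : AFEnd X} {V : Opens X}
    (hV : IsConformalHorizonOutside h w e V) : IsCalS h e V := by
  obtain ⟨S', t, c, m, k, t2, f', ν', -, -, hf', hν', -, hout, -⟩ := hV
  exact ⟨S', t, c, m, k, t2, f', ν', hf', hν', hout⟩

variable [T2Space X] [LocallyCompactSpace X] [MeasurableSpace X] [BorelSpace X]

/-- **Bray's conformal flow of metrics: a solution as in Thm. 2** (Bray, J. Differential
Geom. 59 (2001), §3). On `(X, g₀ = h)` with chosen end `e` and initial horizon
`Σ₀ = frontier U₀` (outside region `U₀`), the families `u_t, v_t : X → ℝ` and `Σ(t) = frontier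
(U t)` (outside regions `U t`), `t ≥ 0`, solve the system of §3 — *"we define a continuous family
of conformal metrics `g_t = u_t(x)⁴ g₀` and `u₀(x) ≡ 1`. Given the metric `g_t`, define `Σ(t)` =
the outermost minimal area enclosure of `Σ₀` in `(M³, g_t)` where … we stay inside the collection
of surfaces `𝒮`. … Then given the horizon `Σ(t)`, define `v_t(x)` such that `Δ_{g₀} v_t ≡ 0`
outside `Σ(t)`, `v_t = 0` on `Σ(t)`, `lim_{x→∞} v_t(x) = -e^{-t}`, and `v_t ≡ 0` inside `Σ(t)`.
Finally, given `v_t`, define `u_t(x) = 1 + ∫₀ᵗ v_s(x) ds`"* — with the properties asserted by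
**Thm. 2**: *"[the system] has a solution which is Lipschitz in the `t` variable, `C¹` in the `x`
variable everywhere, and smooth in the `x` variable outside `Σ(t)`. Furthermore, `Σ(t)` is a
smooth, strictly outer-minimizing horizon in `(M³, g_t)` for all `t ≥ 0`, and `Σ(t₂)` encloses
but does not touch `Σ(t₁)` for all `t₂ > t₁ ≥ 0`"*, and the sentence following it, *"`u_t(x) > 0`
for all `t`"*. Fields (all for `t ≥ 0`): `u_zero` (`u₀ ≡ 1`); `enclosure` (`Σ(t)` is the
outermost minimal area enclosure of `Σ₀` in `g_t = u_t⁴ g₀`, within `𝒮`); `harmonic`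
(`Δ_{g₀} v_t = 0` on the outside `U t`, `dalembertian` of `ofRiemannian h`), `v_eq_zero` (`v_t = 0`
on and inside `Σ(t)`, i.e. off `U t`), `tendsto_v` (`v_t → -e^{-t}` at infinity in `e`,
`TendstoAtEnd`), `continuous_v`, `contMDiffOn_v` (`v_t` continuous, smooth outside `Σ(t)` — the
solution of the Dirichlet problem), `intervalIntegrable_v` and `u_eq` (`u_t = 1 + ∫₀ᵗ v_s ds`, a
genuine integral, Lemma 8); `lipschitz` (`t ↦ u_t(x)` Lipschitz on `[0, ∞)` for each `x`),
`contMDiff_u` (`C¹` in `x`), `contMDiffOn_u` (smooth outside `Σ(t)`), `pos` (`u_t > 0`); `horizon`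
(`Σ(t)` is a smooth horizon of `(X, g_t)` of class `𝒮` with outside `U t`),
`strictlyOuterMinimizing` (in `g_t`, Def. 6); `closure_subset` (`Σ(t₂)` encloses `Σ(t₁)`,
`U t₂ ⊆ U t₁`, and does not touch it: `closure (U t₂) ⊆ U t₁`).
[cite: BrayRPI2001, §3 (the conformal flow) and Thm. 2, with §4 Def. 10 and Lemma 8] -/
structure IsConformalFlow (e : AFEnd X) (U₀ : Opens X) (u v : ℝ → X → ℝ) (U : ℝ → Opens X) :
    Prop where
  /-- `u₀ ≡ 1`. -/
  u_zero : u 0 = fun _ ↦ 1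
  /-- `Σ(t) = frontier (U t)` is the outermost minimal area enclosure of `Σ₀` in `g_t`, in `𝒮`. -/
  enclosure : ∀ t, 0 ≤ t → IsOutermostMinimalAreaEnclosure h (u t) e U₀ (U t)
  /-- `Δ_{g₀} v_t = 0` outside `Σ(t)`. -/
  harmonic : ∀ t, 0 ≤ t → ∀ x ∈ (U t : Set X), (ofRiemannian h).dalembertian (v t) x = 0
  /-- `v_t = 0` on and inside `Σ(t)`. -/
  v_eq_zero : ∀ t, 0 ≤ t → ∀ x, x ∉ (U t : Set X) → v t x = 0
  /-- `v_t → -e^{-t}` at infinity (in the chosen end). -/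
  tendsto_v : ∀ t, 0 ≤ t → TendstoAtEnd e (v t) (-Real.exp (-t))
  /-- `v_t` is continuous. -/
  continuous_v : ∀ t, 0 ≤ t → Continuous (v t)
  /-- `v_t` is smooth outside `Σ(t)`. -/
  contMDiffOn_v : ∀ t, 0 ≤ t → ContMDiffOn (𝓡 3) 𝓘(ℝ, ℝ) ∞ (v t) (U t : Set X)
  /-- `s ↦ v_s(x)` is integrable on `[0, t]`. -/
  intervalIntegrable_v : ∀ x t, 0 ≤ t → IntervalIntegrable (fun s ↦ v s x) volume 0 t
  /-- `u_t(x) = 1 + ∫₀ᵗ v_s(x) ds`. -/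
  u_eq : ∀ t, 0 ≤ t → ∀ x, u t x = 1 + ∫ s in (0 : ℝ)..t, v s x
  /-- `u` is Lipschitz in `t`. -/
  lipschitz : ∀ x, ∃ K, LipschitzOnWith K (fun t ↦ u t x) (Ici 0)
  /-- `u_t` is `C¹` in `x` everywhere. -/
  contMDiff_u : ∀ t, 0 ≤ t → ContMDiff (𝓡 3) 𝓘(ℝ, ℝ) 1 (u t)
  /-- `u_t` is smooth in `x` outside `Σ(t)`. -/
  contMDiffOn_u : ∀ t, 0 ≤ t → ContMDiffOn (𝓡 3) 𝓘(ℝ, ℝ) ∞ (u t) (U t : Set X)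
  /-- `u_t > 0`. -/
  pos : ∀ t, 0 ≤ t → ∀ x, 0 < u t x
  /-- `Σ(t)` is a smooth horizon of `(X, g_t)` of class `𝒮` with outside `U t`. -/
  horizon : ∀ t, 0 ≤ t → IsConformalHorizonOutside h (u t) e (U t)
  /-- `Σ(t)` is strictly outer-minimizing in `(X, g_t)`. -/
  strictlyOuterMinimizing : ∀ t, 0 ≤ t → IsStrictlyOuterMinimizing h (u t) e (U t)
  /-- `Σ(t₂)` encloses but does not touch `Σ(t₁)` for `t₂ > t₁ ≥ 0`. -/
  closure_subset : ∀ t₁ t₂, 0 ≤ t₁ → t₁ < t₂ → closure (U t₂ : Set X) ⊆ (U t₁ : Set X)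

/-- **`A(t)`, the total area of the horizon `Σ(t)` in `(M³, g_t)`** (Bray 2001, §3, Def. 7), for
`Σ(t) = frontier (U t)` and `g_t = u_t⁴ h`: `conformalArea h (u t) (frontier (U t))`.
[cite: BrayRPI2001, §3 Def. 7] -/
def flowArea (u : ℝ → X → ℝ) (U : ℝ → Opens X) (t : ℝ) : ℝ≥0∞ :=
  conformalArea h (u t) (frontier (U t : Set X))

namespace IsConformalFlow

variable {h} {e : AFEnd X} {U₀ : Opens X} {u v : ℝ → X → ℝ} {U : ℝ → Opens X}

/-- `Σ(t)` encloses `Σ₀`: `U t ⊆ U₀`. Bray 2001, §3. [cite: BrayRPI2001, §3 (definition of Σ(t))] -/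
theorem le_init (F : IsConformalFlow h e U₀ u v U) {t : ℝ} (ht : 0 ≤ t) : U t ≤ U₀ :=
  (F.enclosure t ht).1.2.1

/-- `Σ(t)` is a surface of `𝒮`. Bray 2001, §3. [cite: BrayRPI2001, §3 (definition of Σ(t))] -/
theorem isCalS (F : IsConformalFlow h e U₀ u v U) {t : ℝ} (ht : 0 ≤ t) : IsCalS h e (U t) :=
  (F.enclosure t ht).1.1

/-- The outside regions decrease: `Σ(t₂)` encloses `Σ(t₁)` for `t₂ ≥ t₁ ≥ 0`. Bray 2001, Thm. 2
(and §4, Cor. 3). [cite: BrayRPI2001, Thm. 2] -/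
theorem antitone (F : IsConformalFlow h e U₀ u v U) {t₁ t₂ : ℝ} (ht₁ : 0 ≤ t₁) (ht : t₁ ≤ t₂) :
    U t₂ ≤ U t₁ := by
  rcases ht.eq_or_lt with rfl | hlt
  · exact le_rfl
  · exact fun x hx ↦ F.closure_subset t₁ t₂ ht₁ hlt (subset_closure hx)

/-- `u₀(x) = 1`. Bray 2001, §3. [cite: BrayRPI2001, §3 (u₀ ≡ 1)] -/
theorem u_zero_apply (F : IsConformalFlow h e U₀ u v U) (x : X) : u 0 x = 1 :=
  congrFun F.u_zero x

/-- `A(0)` is the `h`-area of `Σ(0)`. [folklore] -/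
theorem flowArea_zero (F : IsConformalFlow h e U₀ u v U) :
    flowArea h u U 0 = area h (frontier (U 0 : Set X)) := by
  simp [flowArea, F.u_zero]

/-- If `Σ₀ ∈ 𝒮` is strictly outer-minimizing then `Σ(0) = Σ₀` (`Σ(0)` is a minimal area
enclosure of `Σ₀` in `g₀`). Bray 2001, §3 (*"`Σ(t)` will not touch `Σ₀`, from which it follows
that `Σ(t)` is actually a strictly outer-minimizing horizon"*) and Def. 6. [cite: BrayRPI2001, §3 and §2 Def. 6] -/
theorem init_eq_zero (F : IsConformalFlow h e U₀ u v U) (hU₀ : IsCalS h e U₀)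
    (hmin : IsStrictlyOuterMinimizing h (fun _ ↦ (1 : ℝ)) e U₀) : U 0 = U₀ := by
  have h0 := (F.enclosure 0 le_rfl).1
  rw [F.u_zero] at h0
  exact h0.eq_of_isStrictlyOuterMinimizing h hU₀ hmin

/-- If `Σ₀ ∈ 𝒮` is outer-minimizing then `A(0) = |Σ₀|_{g₀}`. Bray 2001, §4, Lemma 5 at `t = 0`.
[cite: BrayRPI2001, §4 Lemma 5] -/
theorem flowArea_zero_eq_of_isOuterMinimizing (F : IsConformalFlow h e U₀ u v U)
    (hU₀ : IsCalS h e U₀) (hmin : IsOuterMinimizing h (fun _ ↦ (1 : ℝ)) e U₀) :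
    flowArea h u U 0 = area h (frontier (U₀ : Set X)) := by
  have h0 := (F.enclosure 0 le_rfl).1
  rw [F.u_zero] at h0
  rw [F.flowArea_zero]
  simpa using h0.conformalArea_eq_of_isOuterMinimizing h hU₀ hmin

end IsConformalFlow

end Flow

/-! ### The conclusions of Thms. 2–4 for given data, and the assembly of §3 -/

section Assembly

variable [IsManifold (𝓡 3) ∞ X] [T2Space X] [LocallyCompactSpace X] [MeasurableSpace X]
  [BorelSpace X] (D : InitialDataSet (𝓡 3) X) [D.metric.HasLeviCivita] (e : AFEnd X)

/-- **The data `(X, g₀ = h)` carry a conformal flow from `Σ₀ = frontier U₀` with the properties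
of Thms. 2, 3 and 4** (Bray, J. Differential Geom. 59 (2001), §3): there are `u_t`, `v_t`,
`Σ(t) = frontier (U t)` forming a solution as in Thm. 2 (`IsConformalFlow`), with
`A(t) = |Σ₀|_{g₀}` for all `t ≥ 0` (Thm. 3: *"the function `A(t)` is constant in `t`"*, and §4,
Lemma 5: `|Σ(t)|_{g_t} = A₀`, `A₀` the area of `Σ₀` in `g₀`; here `area D.h (frontier U₀)`), and
total masses `m(t)` of `(X, g_t)` in the end `e` (Def. 8, `HasConformalHFMass`) with `m`
nonincreasing on `[0, ∞)` (Thm. 3: *"`m(t)` is non-increasing in `t`, for all `t ≥ 0`"*) and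
`lim_{t→∞} m(t)/√A(t) = √(1/16π)` (Thm. 4, its last clause; `A(t).toReal`). This is a
**predicate on the data**, asserting nothing: Bray proves it (Thms. 2–4, §§4–12) under the
Assumption of §3 — `(M³, g₀)` complete, harmonically flat, `R ≥ 0`, `Σ₀ ∈ 𝒮` an outer-minimizing
horizon — for the solution constructed in §4 (no uniqueness for the system of §3 is claimed,
which is why the three theorems are recorded as properties of one solution); that existence
statement, the analytic heart of the paper, is **not** vendored in this file (it would be an
unproved named fact; see the module docstring) and enters the assembly below as the hypothesis
`HasConformalFlowHF D e U₀`. [cite: BrayRPI2001, §3 Thms. 2, 3, 4 with Defs. 7–8 and §4 Lemma 5] -/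
def HasConformalFlowHF (U₀ : Opens X) : Prop :=
  ∃ (u v : ℝ → X → ℝ) (U : ℝ → Opens X), IsConformalFlow D.h e U₀ u v U ∧
    (∀ t, 0 ≤ t → flowArea D.h u U t = area D.h (frontier (U₀ : Set X))) ∧
    ∃ m : ℝ → ℝ, (∀ t, 0 ≤ t → HasConformalHFMass e D (u t) (m t)) ∧ AntitoneOn m (Ici 0) ∧
      Tendsto (fun t ↦ m t / Real.sqrt (flowArea D.h u U t).toReal) atTop
        (𝓝 (Real.sqrt (1 / (16 * π))))

variable {D e}

/-- **The Riemannian Penrose inequality for harmonically flat manifolds from Thms. 2–4**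
(theorem; Bray, J. Differential Geom. 59 (2001), §3: *"inequality [`m ≥ √(A/16π)` of Theorem 1]
then follows from theorems 2, 3 and 4, for harmonically flat manifolds"*). If the end `e` is
harmonically flat of total mass `m₀` (Def. 2) and the data carry a conformal flow from
`Σ₀ = frontier U₀` with the properties of Thms. 2–4 (`HasConformalFlowHF`), then
`√(|Σ₀|_{g₀}/16π) ≤ m₀`. Proof (Bray's paragraph, machine-checked): `m(0) = m₀` since `u₀ ≡ 1`
(`HasConformalHFMass.eq_of_hasHarmonicallyFlatMass`); `A(t) = A₀ = |Σ₀|_{g₀}`, so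
`m(t)/√A₀ → √(1/16π)`; if `A₀.toReal = 0` this limit clause is contradictory (the quotient is
`0`), otherwise `m(t) → √(1/16π) √A₀ = √(A₀/16π)`, and `m₀ = m(0) ≥ m(t)` for `t ≥ 0`, whence
`m₀ ≥ √(A₀/16π)` (`le_of_tendsto`). No hypothesis on `Σ₀` is needed for this step: they enter
only the existence of the flow.
[cite: BrayRPI2001, §3 (inequality of Thm. 1 for harmonically flat manifolds from Thms. 2–4)] -/
theorem rpi_harmonicallyFlat_of_hasConformalFlowHF {U₀ : Opens X} {m₀ : ℝ}
    (hm₀ : e.HasHarmonicallyFlatMass D m₀) (hF : HasConformalFlowHF D e U₀) :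
    Real.sqrt ((area D.h (frontier (U₀ : Set X))).toReal / (16 * π)) ≤ m₀ := by
  obtain ⟨u, v, U, hfl, hA, m, hm, hanti, hlim⟩ := hF
  -- `m(0) = m₀`: at `t = 0` the conformal factor is `1` and Def. 2 masses are well defined
  have hm0 : m 0 = m₀ := by
    have h0 := hm 0 le_rfl
    rw [hfl.u_zero] at h0
    exact h0.eq_of_hasHarmonicallyFlatMass hm₀
  set A₀ : ℝ := (area D.h (frontier (U₀ : Set X))).toReal with hA₀
  -- `A(t) = A₀`, so `m(t)/√A₀ → √(1/16π)`
  have hlim' : Tendsto (fun t ↦ m t / Real.sqrt A₀) atTop (𝓝 (Real.sqrt (1 / (16 * π)))) := by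
    refine hlim.congr' ?_
    filter_upwards [eventually_ge_atTop (0 : ℝ)] with t ht
    rw [hA t ht]
  have hc0 : 0 < Real.sqrt (1 / (16 * π)) := Real.sqrt_pos.2 (by positivity)
  -- `m` is nonincreasing on `[0, ∞)`, so `m(t) ≤ m(0) = m₀` for `t ≥ 0`
  have hmle : ∀ᶠ t in atTop, m t ≤ m₀ := by
    filter_upwards [eventually_ge_atTop (0 : ℝ)] with t ht
    rw [← hm0]
    exact hanti Set.self_mem_Ici (Set.mem_Ici.2 ht) ht
  by_cases hA0 : A₀ = 0
  · -- excluded value: the quotient would be identically `0`, contradicting the limit clause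
    have h0 : Tendsto (fun _ : ℝ ↦ (0 : ℝ)) atTop (𝓝 (Real.sqrt (1 / (16 * π)))) :=
      hlim'.congr' (Eventually.of_forall fun t ↦ by simp [hA0])
    exact absurd (tendsto_nhds_unique h0 tendsto_const_nhds) hc0.ne'
  · have hA0pos : 0 < A₀ := lt_of_le_of_ne ENNReal.toReal_nonneg (Ne.symm hA0)
    have hsq : 0 < Real.sqrt A₀ := Real.sqrt_pos.2 hA0pos
    have hmt : Tendsto m atTop (𝓝 (Real.sqrt (1 / (16 * π)) * Real.sqrt A₀)) := by
      refine (hlim'.mul_const (Real.sqrt A₀)).congr' (Eventually.of_forall fun t ↦ ?_)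
      exact div_mul_cancel₀ (m t) hsq.ne'
    have hle : Real.sqrt (1 / (16 * π)) * Real.sqrt A₀ ≤ m₀ := le_of_tendsto hmt hmle
    calc Real.sqrt (A₀ / (16 * π)) = Real.sqrt (1 / (16 * π)) * Real.sqrt A₀ := by
          rw [← one_div_mul_eq_div, Real.sqrt_mul (by positivity)]
      _ ≤ m₀ := hle

/-- The same for a horizon `Σ₀ = range f₀` given with its outside region `U₀` (`IsOutsideOf`,
`frontier U₀ = range f₀`): `√(|Σ₀|/16π) ≤ m₀` with `|Σ₀| = area D.h (range f₀)`, the `h`-area of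
the image. Bray 2001, §3 (Thm. 1 for harmonically flat manifolds).
[cite: BrayRPI2001, §3 (inequality of Thm. 1 for harmonically flat manifolds from Thms. 2–4)] -/
theorem IsOutsideOf.rpi_harmonicallyFlat_of_hasConformalFlowHF {U₀ : Opens X} {S₀ : Type*}
    {f₀ : S₀ → X} {ν₀ : NormalField (𝓡 3) f₀} (hout : IsOutsideOf e U₀ f₀ ν₀) {m₀ : ℝ}
    (hm₀ : e.HasHarmonicallyFlatMass D m₀) (hF : HasConformalFlowHF D e U₀) :
    Real.sqrt ((area D.h (range f₀)).toReal / (16 * π)) ≤ m₀ := by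
  rw [← hout.frontier_eq]
  exact Literature.Geometry.Lorentzian.rpi_harmonicallyFlat_of_hasConformalFlowHF hm₀ hF

end Assembly

end Literature.Geometry.Lorentzian

end
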